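import Literature.MathematicalPhysics.QuantumFieldTheory.Balaban1983to89.HaarAnalyticZeroSetNullLocalNormThreshold
import Literature.MathematicalPhysics.QuantumFieldTheory.Balaban1983to89.Node00.SmallFieldChiOfRecord
import Literature.MathematicalPhysics.QuantumFieldTheory.Balaban1983to89.Node00.SmallFieldChiFixedOfRecord
import HarnessLib

/-!
# `BalabanUVNodes.N09Chi217AEContinuous` — THE (2.17) SMALL-FIELD FUNCTION OF RECORD `χ_k(T_η)` IS `dU`-A.E. CONTINUOUS ON EVERY
# OPEN SET OF CONFIGURATIONS WHERE THE LOCAL MINIMISERS' PLAQUETTE VARIABLES ARE REAL-ANALYTIC — the (2.17) twin of this seat's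
# g3 `…N09ContourThresholdNull` ∕ `…N09AveragingAEContinuous`, closed MODULO exactly one displayed input (N07 ∕ [15] Thm 1 class)

Cell `pub-ymgap`, YM-PLAN Track A, DAG node N09 [Balaban1987RG1]; seat `pub-ymgap-dag-n09-w3` g4 (the located line of g3's
`HANDOFF.md` §g3.3: «(2.17) `chiOfRecord` LOCATED-NOT-TYPED: its threshold functional is analytic in the field only on the small-field
domain … a local (open-set) version of the zero-set engine + an analyticity-on-domain statement for the minimiser would be the road»).
`--kind proof --supports stmt-QuantumFields-26907 --as helper` (K1⁸ per dag-lead KEY MAP v1.65), COUNT-NEUTRAL.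

HONEST FRAMING.  Kernel measure ∕ topology bookkeeping on NODE 00's (2.17) function of record read BY NAME
(`Node00.chiOfRecord`, `chiOfRecord_eq_chi217`, `B14.Eq216Concrete.chi217_apply ∕ chi217_eq_one_iff`, `Setup.chiSmall ∕ PlaqSmallOn`,
`ukBox`), over this seat's Literature engine `HaarAnalyticZeroSetNullLocalNormThreshold.fieldMeasure_ae_eventually_forall_norm_sub_one_lt_iff`
(operator-norm small-field conditions of real-analytic unitary-valued functionals are `dU`-a.e. locally constant, NO connectedness ∕ witness ∕
chart-surjectivity hypothesis).  The ONE analytic input is DISPLAYED, not proved: an open set `W` of level-`k` configurations and ambient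
real-analytic functions `w_{□,p}` on `W` that AGREE on `SU(N)`-configurations in `W` with the plaquette variables `U_{k,□}(V_k, ∂p)` of the
local minimisers of record (2.16) (`ukBox` over def-R's solution map `UminOfRecord`) — i.e. «the local minimiser is real-analytic in `V_k`
on `W`», [Balaban1985PropagatorsII] Thm 1's class at the record; it is N07's ∕ def-R's ∕ (F1)'s content and is NOT asserted here (with
`W = ∅` the statement is empty; its content is exactly as large as the analyticity domain supplied).  NOTHING of Bałaban's analysis is
asserted; no carrier re-pointed; `hreg`∕`contTOn` stay DISPLAYED; N09 NOT discharged; conjunct 1 ∕ FLAG №7 untouched; K0⁷ ∕ K1⁸ ∕ K3⁷ NOT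
closed; counts unmoved (typed 28∕28 · discharged 5∕27); R4 = the conditional finite-𝕋⁴ rung `BalabanLadder.UV` only; the Yang–Mills mass gap
(Clay) is NOT proved by any of this; nothing continuum ∕ ℝ⁴ ∕ OS.

WHAT IS PROVED (theorems only; 0 definitions; 0 sorry; axioms standard).  `SU N = Matrix.specialUnitaryGroup (Fin N) ℂ`, `N ≥ 1`,
`dU = fieldMeasure (F.P K) k (SU N)`; the (2.17) data of record at `(F, N, ν, g, K, k)`: cube family `X`, plaquette sets `plaqT □ = {p ⊂ □^∼}`,
enlarged cubes `□^{∼4}`, threshold `δ = ε_k η²`, local minimisers `U_{k,□}(V_k) = ukBox …` (all spelled out BY NAME from `Node00.SmallFieldChiOfRecord`).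
* §1 `dist1_eq_norm_coe_sub_one` (`dist1 x = ‖↑x − 1‖` on `SU(N)`, `rfl`), `chiOfRecord_eq_zero_of_not` (`χ_k(T_η)(V) = 0` off the joint
  small-field condition), `chiOfRecord_congr_of_iff` (two configurations with the same joint condition have the same `χ`).
* §2 ★★★ **`ae_continuousAt_chiOfRecord_of_analyticOn`**: for every open `W ⊆ (PBond → M_N(ℂ))` and every family of ambient
  real-analytic `w_q : (PBond → M_N(ℂ)) → M_N(ℂ)` (`q = (□, p)`, `□ ∈ X`, `p ⊂ □^∼`) agreeing on `SU(N)`-configurations in `W` with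
  `↑(U_{k,□}(V_k))(∂p)`: for `dU`-a.e. `V` with `↑V ∈ W`, `χ_k(T_η)` of record is CONTINUOUS at `V`; `ae_eventually_chiOfRecord_eq`
  (the a.e. local-constancy form).

References: T. Bałaban, CMP **109** (1987) [Balaban1987RG1] (2.17) p. 266; CMP **119** (1988) [Balaban1988Convergent] (2.16)–(2.17)
p. 257; CMP **98** (1985) [Balaban1985Averaging] (10) p. 19, (19) p. 21; CMP **102** (1985) 277–309 [Balaban1985PropagatorsII] Thm 1
(the analyticity class — named, not asserted); B. S. Mityagin [Mityagin2015] Prop. 1; Bröcker–tom Dieck [BrockerTomDieck1985] IV (2.11);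
Horn–Johnson [HornJohnson2013] §5.6.
-/

noncomputable section

open Set Function Filter Topology MeasureTheory
open scoped ENNReal NNReal Matrix.Norms.L2Operator

namespace Summit.QuantumFields.YangMills.BalabanUVNodes.N09Chi217AEContinuous

open Literature.MathematicalPhysics.QuantumFieldTheory
open Literature.MathematicalPhysics.QuantumFieldTheory.Balaban1983to89
open T4Continuum B14.Eq216Concrete
open Node00 (Stage7Numerics chiOfRecord chiOfRecord_eq_chi217 chiOfRecord_eq_one_iff cubeIndices cubeSide cubeEnl plaqInside
  RkOfRecord epsOfRecord bgOfRecord avOfRecord chiFixOfRecord Uk)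
open HaarAnalyticZeroSetNullLocalNormThreshold (fieldMeasure_ae_eventually_forall_norm_sub_one_lt_iff)

variable (F : T4Family) (N : ℕ) [NeZero N] (ν : Stage7Numerics) (g : ℕ → ℝ) (K k : ℕ)

/-! ## §1 Bookkeeping on the (2.17) function of record -/

/-- On `SU(N)` the print's distance `|x − 1|` is the L²-operator norm `‖↑x − 1‖` (definitional for `UnitaryModel.instGaugeGroupSpecialUnitaryGroup`).
[cite: Balaban1985Averaging, (19) p.21] -/
theorem dist1_eq_norm_coe_sub_one (x : Matrix.specialUnitaryGroup (Fin N) ℂ) :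
    dist1 x = ‖(x : Matrix (Fin N) (Fin N) ℂ) - 1‖ := rfl

/-- `χ_k(T_η)(V) = 0` as soon as ONE cube `□ ∈ X` has a plaquette `p ⊂ □^∼` violating `|U_{k,□}(V_k, ∂p) − 1| < ε_kη²` (a product of
0∕1 characteristic functions with a vanishing factor). [cite: Balaban1988Convergent, (2.17) p.257] -/
theorem chiOfRecord_eq_zero_of_not (V : GaugeField (F.P K) k (Matrix.specialUnitaryGroup (Fin N) ℂ))
    (hV : ¬ ∀ a ∈ cubeIndices (F.P K) (cubeSide (F.P K).L ν.M₂ (RkOfRecord (F.P K).L ν.r (g k)) k),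
      PlaqSmallOn (plaqInside (cubeEnl (F.P K) (cubeSide (F.P K).L ν.M₂ (RkOfRecord (F.P K).L ν.r (g k)) k) a 1))
        (epsOfRecord ν g k * (F.P K).eta k ^ 2)
        (ukBox (bgOfRecord (avOfRecord F N K) {U | PlaqSmall (ν.εreg * (F.P K).eta k ^ 2) U}) ν.M₁
          (cubeEnl (F.P K) (cubeSide (F.P K).L ν.M₂ (RkOfRecord (F.P K).L ν.r (g k)) k) a 4) k V)) :
    chiOfRecord F N ν g K k V = 0 := by
  classical
  push Not at hV
  obtain ⟨a, ha, hna⟩ := hV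
  rw [chiOfRecord_eq_chi217, chi217_apply]
  exact Finset.prod_eq_zero ha (by
    unfold chiSmall
    exact if_neg hna)

/-- Two configurations satisfying the joint (2.17) small-field condition SIMULTANEOUSLY or NOT have the same `χ_k(T_η)`.
[cite: Balaban1988Convergent, (2.17) p.257] -/
theorem chiOfRecord_congr_of_iff (V V' : GaugeField (F.P K) k (Matrix.specialUnitaryGroup (Fin N) ℂ))
    (h : (∀ a ∈ cubeIndices (F.P K) (cubeSide (F.P K).L ν.M₂ (RkOfRecord (F.P K).L ν.r (g k)) k),
      PlaqSmallOn (plaqInside (cubeEnl (F.P K) (cubeSide (F.P K).L ν.M₂ (RkOfRecord (F.P K).L ν.r (g k)) k) a 1))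
        (epsOfRecord ν g k * (F.P K).eta k ^ 2)
        (ukBox (bgOfRecord (avOfRecord F N K) {U | PlaqSmall (ν.εreg * (F.P K).eta k ^ 2) U}) ν.M₁
          (cubeEnl (F.P K) (cubeSide (F.P K).L ν.M₂ (RkOfRecord (F.P K).L ν.r (g k)) k) a 4) k V')) ↔
      (∀ a ∈ cubeIndices (F.P K) (cubeSide (F.P K).L ν.M₂ (RkOfRecord (F.P K).L ν.r (g k)) k),
      PlaqSmallOn (plaqInside (cubeEnl (F.P K) (cubeSide (F.P K).L ν.M₂ (RkOfRecord (F.P K).L ν.r (g k)) k) a 1))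
        (epsOfRecord ν g k * (F.P K).eta k ^ 2)
        (ukBox (bgOfRecord (avOfRecord F N K) {U | PlaqSmall (ν.εreg * (F.P K).eta k ^ 2) U}) ν.M₁
          (cubeEnl (F.P K) (cubeSide (F.P K).L ν.M₂ (RkOfRecord (F.P K).L ν.r (g k)) k) a 4) k V))) :
    chiOfRecord F N ν g K k V' = chiOfRecord F N ν g K k V := by
  by_cases hV : ∀ a ∈ cubeIndices (F.P K) (cubeSide (F.P K).L ν.M₂ (RkOfRecord (F.P K).L ν.r (g k)) k),
      PlaqSmallOn (plaqInside (cubeEnl (F.P K) (cubeSide (F.P K).L ν.M₂ (RkOfRecord (F.P K).L ν.r (g k)) k) a 1))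
        (epsOfRecord ν g k * (F.P K).eta k ^ 2)
        (ukBox (bgOfRecord (avOfRecord F N K) {U | PlaqSmall (ν.εreg * (F.P K).eta k ^ 2) U}) ν.M₁
          (cubeEnl (F.P K) (cubeSide (F.P K).L ν.M₂ (RkOfRecord (F.P K).L ν.r (g k)) k) a 4) k V)
  · rw [(chiOfRecord_eq_one_iff F N ν g K k V).2 hV, (chiOfRecord_eq_one_iff F N ν g K k V').2 (h.2 hV)]
  · rw [chiOfRecord_eq_zero_of_not F N ν g K k V hV, chiOfRecord_eq_zero_of_not F N ν g K k V' (fun h' => hV (h.1 h'))]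

/-! ## §2 `χ_k(T_η)` of record is `dU`-a.e. continuous where the local minimisers' plaquette variables are real-analytic -/

/-- ★★★ **`χ_k(T_η)` OF RECORD IS `dU`-A.E. CONTINUOUS ON EVERY OPEN SET WHERE THE LOCAL MINIMISERS' PLAQUETTE VARIABLES EXTEND
REAL-ANALYTICALLY.**  Data: an open `W ⊆ (PBond → M_N(ℂ))`; for each pair `q = (□, p)` with `□ ∈ X` (the `LM₂R_k`-cube family of record) and
`p ⊂ □^∼`, an ambient function `w_q : (PBond → M_N(ℂ)) → M_N(ℂ)` real-analytic on `W` (`hw`) that AGREES on `SU(N)`-configurations in `W`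
with the plaquette variable `↑(U_{k,□}(V_k))(∂p)` of the local minimiser (2.16) of record (`hagree` — the DISPLAYED analyticity input, N07 ∕
[15] Thm 1 class).  Conclusion: for `dU`-a.e. `V` with `↑V ∈ W`, `ContinuousAt (χ_k(T_η)) V`.  Proof: the joint condition `∀ q, ‖w_q − 1‖ < ε_kη²`
is `dU`-a.e. locally constant on `W` (this seat's `fieldMeasure_ae_eventually_forall_norm_sub_one_lt_iff`; the plaquette variables are
unitary), it IS the (2.17) condition on `W` (`hagree`, `dist1 = ‖· − 1‖`), and `χ` is a function of that condition (§1).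
[cite: Balaban1987RG1, (2.17) p.266] [cite: Balaban1988Convergent, (2.16)–(2.17) p.257] [cite: Balaban1985Averaging, (10) p.19, (19) p.21]
[cite: Mityagin2015, Proposition 1] [cite: BrockerTomDieck1985, IV (2.11) (proof)] -/
theorem ae_continuousAt_chiOfRecord_of_analyticOn {W : Set (PBond (F.P K) k → Matrix (Fin N) (Fin N) ℂ)} (hW : IsOpen W)
    (w : {q : ↥(cubeIndices (F.P K) (cubeSide (F.P K).L ν.M₂ (RkOfRecord (F.P K).L ν.r (g k)) k)) × Plaq (F.P K) 0 //
        q.2 ∈ plaqInside (cubeEnl (F.P K) (cubeSide (F.P K).L ν.M₂ (RkOfRecord (F.P K).L ν.r (g k)) k) q.1.1 1)} →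
      (PBond (F.P K) k → Matrix (Fin N) (Fin N) ℂ) → Matrix (Fin N) (Fin N) ℂ)
    (hw : ∀ q, AnalyticOnNhd ℝ (w q) W)
    (hagree : ∀ q (V : GaugeField (F.P K) k (Matrix.specialUnitaryGroup (Fin N) ℂ)),
      (fun b => (V b : Matrix (Fin N) (Fin N) ℂ)) ∈ W →
        w q (fun b => (V b : Matrix (Fin N) (Fin N) ℂ)) =
          ((GaugeField.plaqHol (ukBox (bgOfRecord (avOfRecord F N K) {U | PlaqSmall (ν.εreg * (F.P K).eta k ^ 2) U}) ν.M₁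
            (cubeEnl (F.P K) (cubeSide (F.P K).L ν.M₂ (RkOfRecord (F.P K).L ν.r (g k)) k) q.1.1.1 4) k V) q.1.2 :
              Matrix.specialUnitaryGroup (Fin N) ℂ) : Matrix (Fin N) (Fin N) ℂ)) :
    ∀ᵐ V : PBond (F.P K) k → Matrix.specialUnitaryGroup (Fin N) ℂ ∂(fieldMeasure (F.P K) k (Matrix.specialUnitaryGroup (Fin N) ℂ)),
      (fun b => (V b : Matrix (Fin N) (Fin N) ℂ)) ∈ W →
        ContinuousAt (fun V' : PBond (F.P K) k → Matrix.specialUnitaryGroup (Fin N) ℂ => chiOfRecord F N ν g K k V') V := by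
  -- the plaquette variables are unitary on the trace of `W`
  have hu : ∀ q (V : PBond (F.P K) k → Matrix.specialUnitaryGroup (Fin N) ℂ),
      (fun b => (V b : Matrix (Fin N) (Fin N) ℂ)) ∈ W →
        w q (fun b => (V b : Matrix (Fin N) (Fin N) ℂ)) ∈ Matrix.unitaryGroup (Fin N) ℂ := by
    intro q V hV
    rw [hagree q V hV]
    exact (Matrix.mem_specialUnitaryGroup_iff.1 (Subtype.coe_prop _)).1
  have hcoe : Continuous fun V : PBond (F.P K) k → Matrix.specialUnitaryGroup (Fin N) ℂ =>
      fun b => (V b : Matrix (Fin N) (Fin N) ℂ) :=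
    continuous_pi fun b => continuous_subtype_val.comp (continuous_apply b)
  filter_upwards [fieldMeasure_ae_eventually_forall_norm_sub_one_lt_iff (F.P K) k hW hw hu
    (fun _ => epsOfRecord ν g k * (F.P K).eta k ^ 2)] with V hV hVW
  -- near `V`: `↑V' ∈ W` and the joint norm condition is that of `V`
  have hWn : ∀ᶠ V' in 𝓝 V, (fun b => (V' b : Matrix (Fin N) (Fin N) ℂ)) ∈ W := hcoe.continuousAt.eventually (hW.mem_nhds hVW)
  -- the joint norm condition IS the (2.17) condition on the trace of `W`
  have hiff : ∀ V' : PBond (F.P K) k → Matrix.specialUnitaryGroup (Fin N) ℂ,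
      (fun b => (V' b : Matrix (Fin N) (Fin N) ℂ)) ∈ W →
      ((∀ q, ‖w q (fun b => (V' b : Matrix (Fin N) (Fin N) ℂ)) - 1‖ < epsOfRecord ν g k * (F.P K).eta k ^ 2) ↔
        ∀ a ∈ cubeIndices (F.P K) (cubeSide (F.P K).L ν.M₂ (RkOfRecord (F.P K).L ν.r (g k)) k),
          PlaqSmallOn (plaqInside (cubeEnl (F.P K) (cubeSide (F.P K).L ν.M₂ (RkOfRecord (F.P K).L ν.r (g k)) k) a 1))
            (epsOfRecord ν g k * (F.P K).eta k ^ 2)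
            (ukBox (bgOfRecord (avOfRecord F N K) {U | PlaqSmall (ν.εreg * (F.P K).eta k ^ 2) U}) ν.M₁
              (cubeEnl (F.P K) (cubeSide (F.P K).L ν.M₂ (RkOfRecord (F.P K).L ν.r (g k)) k) a 4) k V')) := by
    intro V' hV'
    constructor
    · intro hall a ha p hp
      have := hall ⟨(⟨a, ha⟩, p), hp⟩
      rw [hagree _ V' hV'] at this
      rw [dist1_eq_norm_coe_sub_one]
      exact this
    · rintro hall ⟨⟨⟨a, ha⟩, p⟩, hp⟩
      rw [hagree _ V' hV', ← dist1_eq_norm_coe_sub_one]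
      exact hall a ha p hp
  have hev : ∀ᶠ V' : PBond (F.P K) k → Matrix.specialUnitaryGroup (Fin N) ℂ in 𝓝 V,
      chiOfRecord F N ν g K k V' = chiOfRecord F N ν g K k V := by
    filter_upwards [hWn, hV hVW] with V' hV'W hV'iff
    exact chiOfRecord_congr_of_iff F N ν g K k V V' (by rw [← hiff V' hV'W, ← hiff V hVW]; exact hV'iff)
  exact (continuousAt_const (y := chiOfRecord F N ν g K k V)).congr_of_eventuallyEq hev

/-- The a.e. LOCAL-CONSTANCY form: under the same displayed input, for `dU`-a.e. `V` with `↑V ∈ W`, `χ_k(T_η)` is constant on a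
neighbourhood of `V`. [cite: Balaban1987RG1, (2.17) p.266] [cite: Balaban1988Convergent, (2.17) p.257] [cite: Mityagin2015, Proposition 1] -/
theorem ae_eventually_chiOfRecord_eq {W : Set (PBond (F.P K) k → Matrix (Fin N) (Fin N) ℂ)} (hW : IsOpen W)
    (w : {q : ↥(cubeIndices (F.P K) (cubeSide (F.P K).L ν.M₂ (RkOfRecord (F.P K).L ν.r (g k)) k)) × Plaq (F.P K) 0 //
        q.2 ∈ plaqInside (cubeEnl (F.P K) (cubeSide (F.P K).L ν.M₂ (RkOfRecord (F.P K).L ν.r (g k)) k) q.1.1 1)} →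
      (PBond (F.P K) k → Matrix (Fin N) (Fin N) ℂ) → Matrix (Fin N) (Fin N) ℂ)
    (hw : ∀ q, AnalyticOnNhd ℝ (w q) W)
    (hagree : ∀ q (V : GaugeField (F.P K) k (Matrix.specialUnitaryGroup (Fin N) ℂ)),
      (fun b => (V b : Matrix (Fin N) (Fin N) ℂ)) ∈ W →
        w q (fun b => (V b : Matrix (Fin N) (Fin N) ℂ)) =
          ((GaugeField.plaqHol (ukBox (bgOfRecord (avOfRecord F N K) {U | PlaqSmall (ν.εreg * (F.P K).eta k ^ 2) U}) ν.M₁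
            (cubeEnl (F.P K) (cubeSide (F.P K).L ν.M₂ (RkOfRecord (F.P K).L ν.r (g k)) k) q.1.1.1 4) k V) q.1.2 :
              Matrix.specialUnitaryGroup (Fin N) ℂ) : Matrix (Fin N) (Fin N) ℂ)) :
    ∀ᵐ V : PBond (F.P K) k → Matrix.specialUnitaryGroup (Fin N) ℂ ∂(fieldMeasure (F.P K) k (Matrix.specialUnitaryGroup (Fin N) ℂ)),
      (fun b => (V b : Matrix (Fin N) (Fin N) ℂ)) ∈ W →
        ∀ᶠ V' : PBond (F.P K) k → Matrix.specialUnitaryGroup (Fin N) ℂ in 𝓝 V,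
          chiOfRecord F N ν g K k V' = chiOfRecord F N ν g K k V := by
  have hu : ∀ q (V : PBond (F.P K) k → Matrix.specialUnitaryGroup (Fin N) ℂ),
      (fun b => (V b : Matrix (Fin N) (Fin N) ℂ)) ∈ W →
        w q (fun b => (V b : Matrix (Fin N) (Fin N) ℂ)) ∈ Matrix.unitaryGroup (Fin N) ℂ := by
    intro q V hV
    rw [hagree q V hV]
    exact (Matrix.mem_specialUnitaryGroup_iff.1 (Subtype.coe_prop _)).1
  have hcoe : Continuous fun V : PBond (F.P K) k → Matrix.specialUnitaryGroup (Fin N) ℂ =>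
      fun b => (V b : Matrix (Fin N) (Fin N) ℂ) :=
    continuous_pi fun b => continuous_subtype_val.comp (continuous_apply b)
  filter_upwards [fieldMeasure_ae_eventually_forall_norm_sub_one_lt_iff (F.P K) k hW hw hu
    (fun _ => epsOfRecord ν g k * (F.P K).eta k ^ 2)] with V hV hVW
  have hWn : ∀ᶠ V' in 𝓝 V, (fun b => (V' b : Matrix (Fin N) (Fin N) ℂ)) ∈ W := hcoe.continuousAt.eventually (hW.mem_nhds hVW)
  have hiff : ∀ V' : PBond (F.P K) k → Matrix.specialUnitaryGroup (Fin N) ℂ,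
      (fun b => (V' b : Matrix (Fin N) (Fin N) ℂ)) ∈ W →
      ((∀ q, ‖w q (fun b => (V' b : Matrix (Fin N) (Fin N) ℂ)) - 1‖ < epsOfRecord ν g k * (F.P K).eta k ^ 2) ↔
        ∀ a ∈ cubeIndices (F.P K) (cubeSide (F.P K).L ν.M₂ (RkOfRecord (F.P K).L ν.r (g k)) k),
          PlaqSmallOn (plaqInside (cubeEnl (F.P K) (cubeSide (F.P K).L ν.M₂ (RkOfRecord (F.P K).L ν.r (g k)) k) a 1))
            (epsOfRecord ν g k * (F.P K).eta k ^ 2)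
            (ukBox (bgOfRecord (avOfRecord F N K) {U | PlaqSmall (ν.εreg * (F.P K).eta k ^ 2) U}) ν.M₁
              (cubeEnl (F.P K) (cubeSide (F.P K).L ν.M₂ (RkOfRecord (F.P K).L ν.r (g k)) k) a 4) k V')) := by
    intro V' hV'
    constructor
    · intro hall a ha p hp
      have := hall ⟨(⟨a, ha⟩, p), hp⟩
      rw [hagree _ V' hV'] at this
      rw [dist1_eq_norm_coe_sub_one]
      exact this
    · rintro hall ⟨⟨⟨a, ha⟩, p⟩, hp⟩
      rw [hagree _ V' hV', ← dist1_eq_norm_coe_sub_one]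
      exact hall a ha p hp
  filter_upwards [hWn, hV hVW] with V' hV'W hV'iff
  exact chiOfRecord_congr_of_iff F N ν g K k V V' (by rw [← hiff V' hV'W, ← hiff V hVW]; exact hV'iff)

/-! ## §3 The FIRST-form fixed-threshold function `χ({|∂U_k(V) − 1| < ε₀η²})` of record (`Node00.chiFixOfRecord`, [I] p. 259) -/

open scoped Classical in
/-- `χ^{fix}(V) = 0` off the condition `∀ p, |U_k(V)(∂p) − 1| < ε₀η_k²`; `= 1` on it (`Setup.chiSmall` over all plaquettes).
[cite: Balaban1987RG1, p.259] -/
theorem chiFixOfRecord_eq_ite (V : GaugeField (F.P K) k (Matrix.specialUnitaryGroup (Fin N) ℂ)) :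
    chiFixOfRecord F N ν K k V =
      if PlaqSmallOn Set.univ (ν.ε₀ * (F.P K).eta k ^ 2) (Uk F N K k ν.εreg V) then 1 else 0 := rfl

open scoped Classical in
/-- ★★★ **THE FIRST-FORM SMALL-FIELD FUNCTION OF RECORD IS `dU`-A.E. CONTINUOUS ON EVERY OPEN SET WHERE THE PLAQUETTE VARIABLES OF THE
GLOBAL BACKGROUND `U_k(V)` EXTEND REAL-ANALYTICALLY.**  Data: an open `W ⊆ (PBond → M_N(ℂ))` and, for every fine plaquette `p`, an ambient
`w_p` real-analytic on `W` agreeing on `SU(N)`-configurations in `W` with `↑(U_k(V))(∂p)` (`Node00.Uk`, node00-def-B's background of record —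
the DISPLAYED analyticity input, [15] Thm 1's class; NOT asserted).  Conclusion: for `dU`-a.e. `V` with `↑V ∈ W`, `χ^{fix}` of record is
continuous at `V`. [cite: Balaban1987RG1, p.259 and (1.2) p.260] [cite: Balaban1985Averaging, (10) p.19, (19) p.21]
[cite: Mityagin2015, Proposition 1] [cite: BrockerTomDieck1985, IV (2.11) (proof)] -/
theorem ae_continuousAt_chiFixOfRecord_of_analyticOn {W : Set (PBond (F.P K) k → Matrix (Fin N) (Fin N) ℂ)} (hW : IsOpen W)
    (w : Plaq (F.P K) 0 → (PBond (F.P K) k → Matrix (Fin N) (Fin N) ℂ) → Matrix (Fin N) (Fin N) ℂ)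
    (hw : ∀ p, AnalyticOnNhd ℝ (w p) W)
    (hagree : ∀ p (V : GaugeField (F.P K) k (Matrix.specialUnitaryGroup (Fin N) ℂ)),
      (fun b => (V b : Matrix (Fin N) (Fin N) ℂ)) ∈ W →
        w p (fun b => (V b : Matrix (Fin N) (Fin N) ℂ)) =
          ((GaugeField.plaqHol (Uk F N K k ν.εreg V) p : Matrix.specialUnitaryGroup (Fin N) ℂ) : Matrix (Fin N) (Fin N) ℂ)) :
    ∀ᵐ V : PBond (F.P K) k → Matrix.specialUnitaryGroup (Fin N) ℂ ∂(fieldMeasure (F.P K) k (Matrix.specialUnitaryGroup (Fin N) ℂ)),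
      (fun b => (V b : Matrix (Fin N) (Fin N) ℂ)) ∈ W →
        ContinuousAt (fun V' : PBond (F.P K) k → Matrix.specialUnitaryGroup (Fin N) ℂ => chiFixOfRecord F N ν K k V') V := by
  have hu : ∀ p (V : PBond (F.P K) k → Matrix.specialUnitaryGroup (Fin N) ℂ),
      (fun b => (V b : Matrix (Fin N) (Fin N) ℂ)) ∈ W →
        w p (fun b => (V b : Matrix (Fin N) (Fin N) ℂ)) ∈ Matrix.unitaryGroup (Fin N) ℂ := by
    intro p V hV
    rw [hagree p V hV]
    exact (Matrix.mem_specialUnitaryGroup_iff.1 (Subtype.coe_prop _)).1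
  have hcoe : Continuous fun V : PBond (F.P K) k → Matrix.specialUnitaryGroup (Fin N) ℂ =>
      fun b => (V b : Matrix (Fin N) (Fin N) ℂ) :=
    continuous_pi fun b => continuous_subtype_val.comp (continuous_apply b)
  filter_upwards [fieldMeasure_ae_eventually_forall_norm_sub_one_lt_iff (F.P K) k hW hw hu
    (fun _ => ν.ε₀ * (F.P K).eta k ^ 2)] with V hV hVW
  have hWn : ∀ᶠ V' in 𝓝 V, (fun b => (V' b : Matrix (Fin N) (Fin N) ℂ)) ∈ W := hcoe.continuousAt.eventually (hW.mem_nhds hVW)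
  have hiff : ∀ V' : PBond (F.P K) k → Matrix.specialUnitaryGroup (Fin N) ℂ,
      (fun b => (V' b : Matrix (Fin N) (Fin N) ℂ)) ∈ W →
      ((∀ p, ‖w p (fun b => (V' b : Matrix (Fin N) (Fin N) ℂ)) - 1‖ < ν.ε₀ * (F.P K).eta k ^ 2) ↔
        PlaqSmallOn Set.univ (ν.ε₀ * (F.P K).eta k ^ 2) (Uk F N K k ν.εreg V')) := by
    intro V' hV'
    constructor
    · intro hall p _
      rw [dist1_eq_norm_coe_sub_one, ← hagree p V' hV']
      exact hall p
    · intro hall p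
      rw [hagree p V' hV', ← dist1_eq_norm_coe_sub_one]
      exact hall p (Set.mem_univ p)
  have hev : ∀ᶠ V' : PBond (F.P K) k → Matrix.specialUnitaryGroup (Fin N) ℂ in 𝓝 V,
      chiFixOfRecord F N ν K k V' = chiFixOfRecord F N ν K k V := by
    filter_upwards [hWn, hV hVW] with V' hV'W hV'iff
    have hc : PlaqSmallOn Set.univ (ν.ε₀ * (F.P K).eta k ^ 2) (Uk F N K k ν.εreg V') ↔
        PlaqSmallOn Set.univ (ν.ε₀ * (F.P K).eta k ^ 2) (Uk F N K k ν.εreg V) := by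
      rw [← hiff V' hV'W, ← hiff V hVW]; exact hV'iff
    rw [chiFixOfRecord_eq_ite, chiFixOfRecord_eq_ite]
    exact if_congr hc rfl rfl
  exact (continuousAt_const (y := chiFixOfRecord F N ν K k V)).congr_of_eventuallyEq hev

end Summit.QuantumFields.YangMills.BalabanUVNodes.N09Chi217AEContinuous

end
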